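import Literature.Computability.AlgebraicComplexity.BI17FundamentalInvariantTensors
import Literature.RingTheory.CentralSimple.SkolemNoether
import HarnessLib

/-!
# The stabilizer of the matrix multiplication tensor (Bürgisser–Ikenmeyer 2017, Thm. 4.5 and
# Cor. 4.6) — PROOFS

P. Bürgisser, C. Ikenmeyer, *Fundamental invariants of orbit closures*, J. Algebra **477** (2017)
390–434 = arXiv:1511.02927 [BurgisserIkenmeyer2017], §4.1 (TeX `main.tex` L1741–1760, held text
`paper:arxiv-1511.02927` p0016:L31–L40). THEOREMS ONLY: this file discharges two named facts of the
sibling statement file `BI17FundamentalInvariantTensors.lean` (val-lit row BI2017-B):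

* `BI2017_thm_4_5_holds : BI2017_thm_4_5` — **Thm. 4.5** (de Groote 1978): "The stabilizer of
  `tr(XYZ)` in `GL_{n²}^3` is given by the transformations `X ↦ AXB⁻¹, Y ↦ BYC⁻¹, Z ↦ CZA⁻¹`, where
  `A,B,C ∈ GL_n`." The inclusion `⊇` is the sibling's PROVED `BI2017_thm_4_5_supset`; the inclusion
  `⊆` is proved here along the printed route "see [BI 2011, Prop. 4.5] for a proof based on
  [Skolem–Noether]" (L1748), using the tree's Skolem–Noether theorem for the matrix algebra
  (`Literature.RingTheory.CentralSimple.Matrix.exists_units_forall_algHom_eq_conj`): if linear maps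
  `f₁, f₂` and a surjective map `f₃` of `M_n(K)` satisfy `tr(f₁(X) f₂(Y) f₃(Z)) = tr(XYZ)`, then with
  `P = f₁(1)`, `Q = f₂(1)` trace nondegeneracy gives `f₁(X) Q = P f₂(X) =: k(X)`, `k` is injective
  hence bijective, `P, Q` are invertible, `θ := k · (PQ)⁻¹` is an algebra endomorphism, hence inner,
  and reading back gives the sandwich form (`exists_units_sandwich_of_trace_mul_mul`). The tensor
  equation `(g₁ ⊗ g₂ ⊗ g₃)·⟨n,n,n⟩ = ⟨n,n,n⟩` becomes this trace identity for the three "column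
  actions" `φ_i(M)_{kl} = ∑_{(p,q)} M_{pq} (g_i)_{(p,q),(k,l)}` by pairing with elementary matrices
  (`trace_single_mul_single_mul_single` is the entry `⟨n,n,n⟩_{abc}`).
* `BI2017_cor_4_6_holds : BI2017_cor_4_6` — **Cor. 4.6**: "The tensor `⟨n,n,n⟩` of matrix
  multiplication has the stabilizer period `1`", by `det(A ⊗ B) = det(A)^n det(B)^n` on the three
  Kronecker factors of Thm. 4.5 (printed proof, L1757–1759).

Honest framing: typed-literature discharges for the cell `val-lit`; nothing here bears on the truth
of VP ≠ VNP.

## References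

* [BurgisserIkenmeyer2017] P. Bürgisser, C. Ikenmeyer, *Fundamental invariants of orbit closures*,
  J. Algebra 477 (2017) 390–434; arXiv:1511.02927, Thm. 4.5, Cor. 4.6.
* H. F. de Groote, *On varieties of optimal algorithms for the computation of bilinear mappings.
  I. The isotropy group of a bilinear mapping*, Theoret. Comput. Sci. 7 (1978) 1–24.
* P. Bürgisser, C. Ikenmeyer, *Geometric complexity theory and tensor rank*, STOC 2011, Prop. 4.5.
-/

noncomputable section

open Matrix

namespace Literature.Computability.AlgebraicComplexity

/-! ### Step 1: the Skolem–Noether step for triples of maps preserving `tr(XYZ)` -/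

section SkolemNoetherStep

variable {K : Type*} [Field K] {m : Type*} [Fintype m] [DecidableEq m]

/-- **de Groote's theorem in trace form.** If `f₁, f₂` are linear endomorphisms of `M_m(K)` and
`f₃` is a surjective map with `tr(f₁(X) f₂(Y) f₃(Z)) = tr(XYZ)` for all `X, Y, Z`, then there are
invertible `A, B, C` with `f₁(X) = AXB⁻¹`, `f₂(Y) = BYC⁻¹`, `f₃(Z) = CZA⁻¹` (BI 2017 Thm. 4.5,
"for a proof based on [Skolem–Noether]", L1748). [cite: BurgisserIkenmeyer2017, Thm. 4.5] -/
theorem exists_units_sandwich_of_trace_mul_mul [Nonempty m]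
    (f₁ f₂ : Matrix m m K →ₗ[K] Matrix m m K) (f₃ : Matrix m m K → Matrix m m K)
    (hf₃ : Function.Surjective f₃)
    (h : ∀ X Y Z : Matrix m m K, trace (f₁ X * f₂ Y * f₃ Z) = trace (X * Y * Z)) :
    ∃ A B C : (Matrix m m K)ˣ,
      (∀ X, f₁ X = (A : Matrix m m K) * X * ((B⁻¹ : (Matrix m m K)ˣ) : Matrix m m K)) ∧
        (∀ Y, f₂ Y = (B : Matrix m m K) * Y * ((C⁻¹ : (Matrix m m K)ˣ) : Matrix m m K)) ∧
        ∀ Z, f₃ Z = (C : Matrix m m K) * Z * ((A⁻¹ : (Matrix m m K)ˣ) : Matrix m m K) := by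
  have h1 : ∀ X Z, trace (f₁ X * f₂ 1 * f₃ Z) = trace (X * Z) := fun X Z => by
    simpa only [mul_one] using h X 1 Z
  have h2 : ∀ Y Z, trace (f₁ 1 * f₂ Y * f₃ Z) = trace (Y * Z) := fun Y Z => by
    simpa only [one_mul] using h 1 Y Z
  -- equality of matrices from traces against all `f₃ Z` (trace nondegeneracy + surjectivity)
  have key : ∀ U V : Matrix m m K, (∀ Z, trace (U * f₃ Z) = trace (V * f₃ Z)) → U = V := by
    intro U V hUV
    refine Matrix.ext_iff_trace_mul_right.mpr fun W => ?_
    obtain ⟨Z, rfl⟩ := hf₃ W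
    exact hUV Z
  have hk : ∀ X, f₁ X * f₂ 1 = f₁ 1 * f₂ X := fun X => key _ _ fun Z => by rw [h1, h2]
  -- `k(X) := f₁(X) f₂(1)`
  obtain ⟨k, k_apply⟩ :
      ∃ k : Matrix m m K →ₗ[K] Matrix m m K, ∀ X, k X = f₁ X * f₂ 1 :=
    ⟨(LinearMap.mulRight K (f₂ 1)).comp f₁, fun X => rfl⟩
  have hk1 : ∀ X Z, trace (k X * f₃ Z) = trace (X * Z) := fun X Z => by rw [k_apply, h1]
  have k_inj : Function.Injective k := by
    rw [injective_iff_map_eq_zero]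
    intro X hX
    refine Matrix.ext_iff_trace_mul_right.mpr fun W => ?_
    rw [← hk1, hX, zero_mul, zero_mul]
  obtain ⟨X₁, hX₁⟩ := LinearMap.surjective_of_injective k_inj 1
  have hQ1 : f₁ X₁ * f₂ 1 = 1 := by rw [← k_apply, hX₁]
  have hP1 : f₁ 1 * f₂ X₁ = 1 := by rw [← hk, hQ1]
  -- `P = f₁(1)`, `Q = f₂(1)` are invertible
  obtain ⟨Qu, hQu⟩ : ∃ Qu : (Matrix m m K)ˣ, (Qu : Matrix m m K) = f₂ 1 :=
    ⟨Units.mkOfMulEqOne _ _ (mul_eq_one_comm.mp hQ1), Units.val_mkOfMulEqOne _⟩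
  obtain ⟨Pu, hPu⟩ : ∃ Pu : (Matrix m m K)ˣ, (Pu : Matrix m m K) = f₁ 1 :=
    ⟨Units.mkOfMulEqOne _ _ hP1, Units.val_mkOfMulEqOne _⟩
  have hf₁ : ∀ X, f₁ X = k X * ((Qu⁻¹ : (Matrix m m K)ˣ) : Matrix m m K) := fun X => by
    rw [k_apply, ← hQu, Units.mul_inv_cancel_right]
  have hf₂ : ∀ Y, f₂ Y = ((Pu⁻¹ : (Matrix m m K)ˣ) : Matrix m m K) * k Y := fun Y => by
    rw [k_apply, hk, ← hPu, Units.inv_mul_cancel_left]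
  -- multiplicativity of `θ := k · (Q⁻¹ P⁻¹)`
  obtain ⟨R, hR⟩ : ∃ R : (Matrix m m K)ˣ, R = Qu⁻¹ * Pu⁻¹ := ⟨_, rfl⟩
  have hRval : (R : Matrix m m K) =
      ((Qu⁻¹ : (Matrix m m K)ˣ) : Matrix m m K) * ((Pu⁻¹ : (Matrix m m K)ˣ) : Matrix m m K) := by
    rw [hR, Units.val_mul]
  have hRinv : ((R⁻¹ : (Matrix m m K)ˣ) : Matrix m m K) = (Pu : Matrix m m K) * (Qu : Matrix m m K) := by
    rw [hR, _root_.mul_inv_rev, inv_inv, inv_inv, Units.val_mul]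
  have hmul : ∀ X Y, k X * (R : Matrix m m K) * k Y = k (X * Y) := fun X Y => key _ _ fun Z => by
    rw [hk1, hRval, ← mul_assoc, ← hf₁, mul_assoc (f₁ X), ← hf₂, h]
  have hone : k 1 * (R : Matrix m m K) = 1 := by
    rw [k_apply, hRval, ← hPu, ← hQu, ← mul_assoc, Units.mul_inv_cancel_right, Units.mul_inv]
  obtain ⟨θ, θ_apply⟩ :
      ∃ θ : Matrix m m K →ₐ[K] Matrix m m K, ∀ X, θ X = k X * (R : Matrix m m K) :=
    ⟨AlgHom.ofLinearMap ((LinearMap.mulRight K (R : Matrix m m K)).comp k) hone fun X Y => by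
        simp only [LinearMap.comp_apply, LinearMap.mulRight_apply]
        rw [← hmul X Y, mul_assoc (k X * (R : Matrix m m K))],
      fun X => rfl⟩
  -- Skolem–Noether: `θ` is inner
  obtain ⟨u, hu⟩ :=
    Literature.RingTheory.CentralSimple.Matrix.exists_units_forall_algHom_eq_conj (K := K) θ
  have hkX : ∀ X, k X = (u : Matrix m m K) * X * ((u⁻¹ : (Matrix m m K)ˣ) : Matrix m m K) *
      ((R⁻¹ : (Matrix m m K)ˣ) : Matrix m m K) := fun X => by
    rw [← hu, θ_apply, Units.mul_inv_cancel_right]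
  refine ⟨u, Pu⁻¹ * u, R * u, fun X => ?_, fun Y => ?_, fun Z => ?_⟩
  · -- `f₁ X = u X u⁻¹ P`
    rw [hf₁, hkX, hRinv, _root_.mul_inv_rev, inv_inv, Units.val_mul]
    simp only [mul_assoc, Units.mul_inv, mul_one]
  · -- `f₂ Y = P⁻¹ u Y u⁻¹ P Q`
    rw [hf₂, hkX, _root_.mul_inv_rev, Units.val_mul, Units.val_mul, hRinv]
    simp only [mul_assoc]
  · -- `f₃ Z = Q⁻¹ P⁻¹ u Z u⁻¹`, from `tr(k(X) f₃(Z)) = tr(XZ)` for all `X`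
    refine Matrix.ext_iff_trace_mul_left.mpr fun X => ?_
    have hX' : k (((u⁻¹ : (Matrix m m K)ˣ) : Matrix m m K) * X * (R : Matrix m m K) *
        (u : Matrix m m K)) = X := by
      rw [hkX]
      simp only [mul_assoc, Units.mul_inv_cancel_left, Units.mul_inv, mul_one]
    calc trace (X * f₃ Z)
        = trace (k (((u⁻¹ : (Matrix m m K)ˣ) : Matrix m m K) * X * (R : Matrix m m K) *
            (u : Matrix m m K)) * f₃ Z) := by rw [hX']
      _ = trace (((u⁻¹ : (Matrix m m K)ˣ) : Matrix m m K) * X * (R : Matrix m m K) *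
            (u : Matrix m m K) * Z) := hk1 _ _
      _ = trace (X * (((R * u : (Matrix m m K)ˣ) : Matrix m m K) * Z *
            ((u⁻¹ : (Matrix m m K)ˣ) : Matrix m m K))) := by
          rw [Units.val_mul]
          simp only [mul_assoc]
          rw [trace_mul_comm]
          simp only [mul_assoc]

end SkolemNoetherStep

/-! ### Step 2: pairing tensors over `[n] × [n]` with elementary matrices -/

section ColumnAction

variable {K : Type*} [Field K] {p : Type*} [Fintype p] [DecidableEq p]

/-- `tr(e_{ij} e_{kl} e_{rs}) = [j = k][l = r][s = i]` — the entries of BI's `⟨n,n,n⟩ = ∑|(ij)(jk)(ki)⟩`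
(`biMatMulTensor`) as traces of products of elementary matrices. [folklore] -/
private theorem trace_single_mul_single_mul_single (i j k l r s : p) :
    trace (single i j (1 : K) * single k l 1 * single r s 1) =
      if j = k ∧ l = r ∧ s = i then 1 else 0 := by
  rw [single_mul_mul_single, one_mul, mul_one]
  by_cases his : i = s
  · subst his
    rw [trace_single_eq_same]
    simp only [single, of_apply, and_true, @eq_comm _ k j]
  · rw [trace_single_eq_of_ne i s _ his]
    have hsi : ¬ (s = i) := fun h => his h.symm
    simp only [hsi, and_false, if_false]

omit [DecidableEq p] in
/-- `tr(PQR) = ∑_{κ,μ,ν} P_{νκ} Q_{κμ} R_{μν}` (in the summation order of the sibling's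
`actTensor_biMatMulTensor_apply`). [folklore] -/
private theorem trace_mul_mul_eq_sum (P Q R : Matrix p p K) :
    trace (P * Q * R) = ∑ κ, ∑ μ, ∑ ν, P ν κ * Q κ μ * R μ ν := by
  have h : trace (P * Q * R) = ∑ ν, ∑ μ, ∑ κ, P ν κ * Q κ μ * R μ ν := by
    simp only [trace, diag_apply, mul_apply, Finset.sum_mul]
  rw [h, Finset.sum_comm]
  refine (Finset.sum_congr rfl fun μ _ => Finset.sum_comm).trans ?_
  rw [Finset.sum_comm]

/-- Trilinear expansion of `tr(φ₁(X) φ₂(Y) φ₃(Z))` in elementary matrices. [folklore] -/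
private theorem trace_map_mul_map_mul_map_eq_sum (φ₁ φ₂ φ₃ : Matrix p p K →ₗ[K] Matrix p p K)
    (X Y Z : Matrix p p K) :
    trace (φ₁ X * φ₂ Y * φ₃ Z) =
      ∑ a : p × p, ∑ b : p × p, ∑ c : p × p, X a.1 a.2 * Y b.1 b.2 * Z c.1 c.2 *
        trace (φ₁ (single a.1 a.2 (1 : K)) * φ₂ (single b.1 b.2 (1 : K)) *
          φ₃ (single c.1 c.2 (1 : K))) := by
  have hexp : ∀ M : Matrix p p K, M = ∑ a : p × p, M a.1 a.2 • single a.1 a.2 (1 : K) := by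
    intro M
    conv_lhs => rw [matrix_eq_sum_single M]
    rw [Fintype.sum_prod_type]
    simp only [smul_single, smul_eq_mul, mul_one]
  conv_lhs => rw [hexp X, hexp Y, hexp Z]
  simp only [map_sum, map_smul]
  rw [Finset.sum_mul_sum]
  simp only [Finset.sum_mul]
  simp only [Finset.mul_sum, trace_sum]
  refine Finset.sum_congr rfl fun a _ => Finset.sum_congr rfl fun b _ =>
    Finset.sum_congr rfl fun c _ => ?_
  rw [smul_mul_smul_comm, smul_mul_smul_comm, trace_smul, smul_eq_mul, mul_assoc]

omit [DecidableEq p] in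
/-- The "column action" of an `[n]² × [n]²` matrix `G` on `n × n` matrices,
`φ(M)_{ij} = ∑_{(p,q)} M_{pq} G_{(p,q),(i,j)}`, exists as a linear map. [folklore] -/
private theorem exists_linearMap_colAct (G : Matrix (p × p) (p × p) K) :
    ∃ φ : Matrix p p K →ₗ[K] Matrix p p K, ∀ M i j, φ M i j = ∑ a : p × p, M a.1 a.2 * G a (i, j) :=
  ⟨{ toFun := fun M => Matrix.of fun i j => ∑ a : p × p, M a.1 a.2 * G a (i, j)
     map_add' := fun M M' => by
       ext i j
       change ∑ a : p × p, (M + M') a.1 a.2 * G a (i, j) =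
         (∑ a : p × p, M a.1 a.2 * G a (i, j)) + ∑ a : p × p, M' a.1 a.2 * G a (i, j)
       rw [← Finset.sum_add_distrib]
       exact Finset.sum_congr rfl fun a _ => by rw [Matrix.add_apply, add_mul]
     map_smul' := fun c M => by
       ext i j
       change ∑ a : p × p, (c • M) a.1 a.2 * G a (i, j) = c * ∑ a : p × p, M a.1 a.2 * G a (i, j)
       rw [Finset.mul_sum]
       exact Finset.sum_congr rfl fun a _ => by rw [Matrix.smul_apply, smul_eq_mul, mul_assoc] },
    fun _ _ _ => rfl⟩

/-- The column action on an elementary matrix reads off a row of `G`. [folklore] -/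
private theorem colAct_single {G : Matrix (p × p) (p × p) K} {φ : Matrix p p K → Matrix p p K}
    (hφ : ∀ M i j, φ M i j = ∑ a : p × p, M a.1 a.2 * G a (i, j)) (q r i j : p) :
    φ (single q r (1 : K)) i j = G (q, r) (i, j) := by
  rw [hφ, Finset.sum_eq_single (q, r)]
  · rw [single_apply_same, one_mul]
  · rintro ⟨b₁, b₂⟩ - hb
    rw [single_apply_of_ne, zero_mul]
    exact fun h => hb (Prod.ext h.1.symm h.2.symm)
  · exact fun h => (h (Finset.mem_univ _)).elim

/-- Column actions compose contravariantly; in particular the action of `G` undoes that of a left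
inverse `G'` (`G' G = 1`). [folklore] -/
private theorem colAct_colAct_of_mul_eq_one {G G' : Matrix (p × p) (p × p) K}
    {φ ψ : Matrix p p K → Matrix p p K}
    (hφ : ∀ M i j, φ M i j = ∑ a : p × p, M a.1 a.2 * G a (i, j))
    (hψ : ∀ M i j, ψ M i j = ∑ a : p × p, M a.1 a.2 * G' a (i, j)) (hGG : G' * G = 1)
    (M : Matrix p p K) : φ (ψ M) = M := by
  ext i j
  rw [hφ]
  simp_rw [hψ]
  simp only [Finset.sum_mul, Prod.mk.eta]
  rw [Finset.sum_comm]
  simp_rw [mul_assoc, ← Finset.mul_sum, ← Matrix.mul_apply, hGG, Matrix.one_apply, mul_ite, mul_one,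
    mul_zero]
  rw [Finset.sum_ite_eq']
  simp

/-- Entries of `A e_{qr} B`. [folklore] -/
private theorem mul_single_one_mul_apply (A B : Matrix p p K) (q r i j : p) :
    (A * single q r (1 : K) * B) i j = A i q * B r j := by
  simp only [mul_apply, single, of_apply, ite_and, mul_ite, ite_mul, mul_one, mul_zero, zero_mul,
    Finset.sum_ite_eq, Finset.mem_univ, if_true]

/-- A unit of `M_p(K)` transposes to a unit. [folklore] -/
private theorem exists_unit_transpose (u : (Matrix p p K)ˣ) :
    ∃ v : (Matrix p p K)ˣ, (v : Matrix p p K) = (u : Matrix p p K)ᵀ ∧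
      ((v⁻¹ : (Matrix p p K)ˣ) : Matrix p p K) = ((u⁻¹ : (Matrix p p K)ˣ) : Matrix p p K)ᵀ :=
  ⟨⟨(u : Matrix p p K)ᵀ, ((u⁻¹ : (Matrix p p K)ˣ) : Matrix p p K)ᵀ,
      by rw [← transpose_mul, Units.inv_mul, transpose_one],
      by rw [← transpose_mul, Units.mul_inv, transpose_one]⟩, rfl, rfl⟩

end ColumnAction

/-! ### Step 3: Theorem 4.5 and Corollary 4.6 -/

/-- For `g ∈ stab(⟨n,n,n⟩)` the three column actions preserve `tr(XYZ)`.
[cite: BurgisserIkenmeyer2017, Thm. 4.5] -/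
theorem trace_colAct_mul_of_mem_tensorStab {n : ℕ}
    {g₁ g₂ g₃ : Matrix (Fin n × Fin n) (Fin n × Fin n) ℂ}
    (hg : actTensor g₁ g₂ g₃ (biMatMulTensor ℂ n) = biMatMulTensor ℂ n)
    (φ₁ φ₂ φ₃ : Matrix (Fin n) (Fin n) ℂ →ₗ[ℂ] Matrix (Fin n) (Fin n) ℂ)
    (hφ₁ : ∀ M i j, φ₁ M i j = ∑ a : Fin n × Fin n, M a.1 a.2 * g₁ a (i, j))
    (hφ₂ : ∀ M i j, φ₂ M i j = ∑ a : Fin n × Fin n, M a.1 a.2 * g₂ a (i, j))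
    (hφ₃ : ∀ M i j, φ₃ M i j = ∑ a : Fin n × Fin n, M a.1 a.2 * g₃ a (i, j))
    (X Y Z : Matrix (Fin n) (Fin n) ℂ) :
    trace (φ₁ X * φ₂ Y * φ₃ Z) = trace (X * Y * Z) := by
  have hid : trace (X * Y * Z) =
      trace (LinearMap.id (R := ℂ) X * LinearMap.id (R := ℂ) Y * LinearMap.id (R := ℂ) Z) := rfl
  rw [hid, trace_map_mul_map_mul_map_eq_sum, trace_map_mul_map_mul_map_eq_sum]
  refine Finset.sum_congr rfl fun a _ => Finset.sum_congr rfl fun b _ =>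
    Finset.sum_congr rfl fun c _ => ?_
  congr 1
  rw [LinearMap.id_apply, LinearMap.id_apply, LinearMap.id_apply,
    trace_single_mul_single_mul_single (K := ℂ), trace_mul_mul_eq_sum]
  simp only [colAct_single hφ₁, colAct_single hφ₂, colAct_single hφ₃, Prod.mk.eta]
  rw [← actTensor_biMatMulTensor_apply, hg]
  rfl

/-- **BI 2017, Thm. 4.5 (de Groote) — DISCHARGED.** `stab(⟨n,n,n⟩) ⊆ GL_{n²}^3` is exactly the set
of triples `(A ⊗ (B⁻¹)ᵀ, B ⊗ (C⁻¹)ᵀ, C ⊗ (A⁻¹)ᵀ)`, `A, B, C ∈ GL_n`. [cite: BurgisserIkenmeyer2017, Thm. 4.5] -/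
theorem BI2017_thm_4_5_holds : BI2017_thm_4_5 := by
  intro n
  refine Set.Subset.antisymm ?_ (BI2017_thm_4_5_supset n)
  intro g hg
  rw [mem_tensorStab_iff] at hg
  rcases Nat.eq_zero_or_pos n with rfl | hn
  · exact ⟨1, 1, 1, Subsingleton.elim _ _, Subsingleton.elim _ _, Subsingleton.elim _ _⟩
  haveI : Nonempty (Fin n) := ⟨⟨0, hn⟩⟩
  obtain ⟨φ₁, hφ₁⟩ := exists_linearMap_colAct (g.1 : Matrix (Fin n × Fin n) (Fin n × Fin n) ℂ)
  obtain ⟨φ₂, hφ₂⟩ := exists_linearMap_colAct (g.2.1 : Matrix (Fin n × Fin n) (Fin n × Fin n) ℂ)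
  obtain ⟨φ₃, hφ₃⟩ := exists_linearMap_colAct (g.2.2 : Matrix (Fin n × Fin n) (Fin n × Fin n) ℂ)
  obtain ⟨ψ, hψ⟩ := exists_linearMap_colAct
    ((g.2.2⁻¹ : GL (Fin n × Fin n) ℂ) : Matrix (Fin n × Fin n) (Fin n × Fin n) ℂ)
  have hsurj : Function.Surjective φ₃ := fun M =>
    ⟨ψ M, colAct_colAct_of_mul_eq_one hφ₃ hψ (Units.inv_mul _) M⟩
  obtain ⟨A₀, B₀, C₀, h₁, h₂, h₃⟩ := exists_units_sandwich_of_trace_mul_mul φ₁ φ₂ φ₃ hsurj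
    (trace_colAct_mul_of_mem_tensorStab hg φ₁ φ₂ φ₃ hφ₁ hφ₂ hφ₃)
  obtain ⟨A, hA, hAi⟩ := exists_unit_transpose A₀
  obtain ⟨B, hB, hBi⟩ := exists_unit_transpose B₀
  obtain ⟨C, hC, hCi⟩ := exists_unit_transpose C₀
  refine ⟨A, B, C, ?_, ?_, ?_⟩
  · ext ⟨q, r⟩ ⟨i, j⟩
    simp only [Matrix.kronecker, kroneckerMap_apply, transpose_apply, hA, hBi]
    rw [← colAct_single hφ₁ q r i j, h₁, mul_single_one_mul_apply]
  · ext ⟨q, r⟩ ⟨i, j⟩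
    simp only [Matrix.kronecker, kroneckerMap_apply, transpose_apply, hB, hCi]
    rw [← colAct_single hφ₂ q r i j, h₂, mul_single_one_mul_apply]
  · ext ⟨q, r⟩ ⟨i, j⟩
    simp only [Matrix.kronecker, kroneckerMap_apply, transpose_apply, hC, hAi]
    rw [← colAct_single hφ₃ q r i j, h₃, mul_single_one_mul_apply]

/-- **BI 2017, Cor. 4.6 — DISCHARGED.** The stabilizer period of `⟨n,n,n⟩` is `1`:
`χ(A ⊗ B⁻ᵀ, B ⊗ C⁻ᵀ, C ⊗ A⁻ᵀ) = (det A det B⁻¹ · det B det C⁻¹ · det C det A⁻¹)^n = 1`.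
[cite: BurgisserIkenmeyer2017, Cor. 4.6] -/
theorem BI2017_cor_4_6_holds : BI2017_cor_4_6 := by
  intro n
  have himg : tensorStabChiImage (biMatMulTensor ℂ n) = {1} := by
    refine Set.eq_singleton_iff_unique_mem.mpr ⟨⟨1, ?_, by simp [tensorChi]⟩, ?_⟩
    · rw [mem_tensorStab_iff]
      simp only [Prod.fst_one, Prod.snd_one, Units.val_one, actTensor_one]
    · rintro x ⟨g, hg, rfl⟩
      rw [BI2017_thm_4_5_holds n] at hg
      obtain ⟨A, B, C, h₁, h₂, h₃⟩ := hg
      apply Units.ext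
      simp only [tensorChi, Units.val_mul, Matrix.GeneralLinearGroup.val_det_apply, h₁, h₂, h₃,
        Units.val_one]
      simp only [Matrix.kronecker]
      rw [det_kronecker, det_kronecker, det_kronecker, det_transpose, det_transpose, det_transpose]
      have hdet : ∀ D : GL (Fin n) ℂ,
          ((D⁻¹ : GL (Fin n) ℂ) : Matrix (Fin n) (Fin n) ℂ).det *
            (D : Matrix (Fin n) (Fin n) ℂ).det = 1 :=
        fun D => by rw [← det_mul, Units.inv_mul, det_one]
      calc (A : Matrix (Fin n) (Fin n) ℂ).det ^ Fintype.card (Fin n) *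
              ((B⁻¹ : GL (Fin n) ℂ) : Matrix (Fin n) (Fin n) ℂ).det ^ Fintype.card (Fin n) *
            ((B : Matrix (Fin n) (Fin n) ℂ).det ^ Fintype.card (Fin n) *
              ((C⁻¹ : GL (Fin n) ℂ) : Matrix (Fin n) (Fin n) ℂ).det ^ Fintype.card (Fin n)) *
            ((C : Matrix (Fin n) (Fin n) ℂ).det ^ Fintype.card (Fin n) *
              ((A⁻¹ : GL (Fin n) ℂ) : Matrix (Fin n) (Fin n) ℂ).det ^ Fintype.card (Fin n))
          = (((A⁻¹ : GL (Fin n) ℂ) : Matrix (Fin n) (Fin n) ℂ).det *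
                (A : Matrix (Fin n) (Fin n) ℂ).det) ^ Fintype.card (Fin n) *
            (((B⁻¹ : GL (Fin n) ℂ) : Matrix (Fin n) (Fin n) ℂ).det *
                (B : Matrix (Fin n) (Fin n) ℂ).det) ^ Fintype.card (Fin n) *
            (((C⁻¹ : GL (Fin n) ℂ) : Matrix (Fin n) (Fin n) ℂ).det *
                (C : Matrix (Fin n) (Fin n) ℂ).det) ^ Fintype.card (Fin n) := by ring
        _ = 1 := by rw [hdet, hdet, hdet, one_pow, one_mul, one_mul]
  unfold tensorStabilizerPeriod
  rw [himg]
  exact Nat.card_unique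

end Literature.Computability.AlgebraicComplexity
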